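import Summits.ResolutionOfSingularities.ResolutionOfSingularities.Theses.UniversalCells
import Summits.ResolutionOfSingularities.ResolutionOfSingularities.Theorems.WeightedInvariantDescentReducedToIntegral
import Summits.ResolutionOfSingularities.ResolutionOfSingularities.Theorems.UniversalCellsPrimeFieldToPerfectStubSpreadOut
import Summits.ResolutionOfSingularities.ResolutionOfSingularities.Theorems.UniversalCellsPrimeFieldToPerfectStubLimitDescent
import Summits.ResolutionOfSingularities.ResolutionOfSingularities.Theorems.UniversalCellsPrimeFieldToPerfectStubSeparableDescent
import HarnessLib

/-!
# Crux `PrimeFieldToPerfect` (stmt-ResolutionOfSingularities-15233) from its kernel `SmoothTwist` alone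

Route `ResolutionOfSingularities/UniversalCells`, crux `PrimeFieldToPerfect`, line `birth` (lead
prover-line-stmt-ResolutionOfSingularities-15233-0, RESHAPE 1). Three of the four registered stubs of the
skeleton `Cruxes/PrimeFieldToPerfect/Lines/birth.lean` are theorems of the tree:

* `PrimeFieldToPerfect.stub_spreadOut` (Theorems/UniversalCellsPrimeFieldToPerfectStubSpreadOut.lean):
  prime field ⇒ finitely generated fields;
* `PrimeFieldToPerfect.stub_limitDescent` (…StubLimitDescent.lean): a smooth model of a finite purely
  inseparable twist ⇒ resolution over the perfect closures of finitely generated fields;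
* `PrimeFieldToPerfect.stub_separableDescent` (…StubSeparableDescent.lean): perfect closures ⇒ all
  perfect fields;

and reduced ⇒ integral over a fixed field is `Theorems.descentReducedToIntegral_proof` (stmt-0551). This
file records, importably and sorry-free, what they buy: **the crux follows from the kernel
`SmoothTwist` alone** (`primeFieldToPerfect_of_smoothTwist`). The hypothesis is VERBATIM the registered
signature of the one open stub `stub_smoothTwist` (universally closed over its parameters): for every
finitely generated field `K` of characteristic `p` and every separated finite-type `X₀/K` which is integral
over some perfect purely inseparable `L ⊇ K`, some FINITE purely inseparable `K'/K` carries a proper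
birational `Y → X₀ ×_K K'` with `Y` SMOOTH over `K'` — granted resolution of integral separated
finite-type schemes over `𝔽_p` and over every finitely generated field of characteristic `p`. When that
statement is proved (as an item or a stub), `PrimeFieldToPerfect` closes by this theorem with no further
work. No new mathematics is claimed here.
-/

noncomputable section

set_option linter.dupNamespace false -- mandated namespace of this single-conjunct summit

open CategoryTheory CategoryTheory.Limits AlgebraicGeometry TopologicalSpace
open Literature.AlgebraicGeometry.Resolution

namespace Summit.ResolutionOfSingularities.ResolutionOfSingularities.Theorems.PrimeFieldToPerfect

/-- **`PrimeFieldToPerfect` from the kernel `SmoothTwist`.** If, for every prime `p`, resolution of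
integral separated finite-type schemes over `Spec (ZMod p)` and over every finitely generated field of
characteristic `p` implies that every separated finite-type `X₀` over a finitely generated `K` which is
integral over some perfect purely inseparable `L ⊇ K` acquires, over some FINITE purely inseparable
`K'/K`, a proper birational model smooth over `K'` — then `UniversalCells.PrimeFieldToPerfect` holds:
prime field ⇒ finitely generated fields (`stub_spreadOut`) ⇒ smooth twisted models (hypothesis) ⇒
perfect closures of finitely generated fields (`stub_limitDescent`) ⇒ all perfect fields
(`stub_separableDescent`) ⇒ reduced schemes (`descentReducedToIntegral_proof`). [folklore] -/
theorem primeFieldToPerfect_of_smoothTwist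
    (hST : ∀ (p : ℕ), p.Prime →
      (∀ (X : Scheme.{0}) (f : X ⟶ Spec (.of (ZMod p))), IsSeparated f → LocallyOfFiniteType f →
        QuasiCompact f → IsIntegral X → Scheme.HasResolution X) →
      (∀ (K : Type) [Field K] [CharP K p], (∃ s : Finset K, Subfield.closure (s : Set K) = ⊤) →
        ∀ (X : Scheme.{0}) (f : X ⟶ Spec (.of K)), IsSeparated f → LocallyOfFiniteType f →
          QuasiCompact f → IsIntegral X → Scheme.HasResolution X) →
      ∀ (K : Type) [Field K] [CharP K p], (∃ s : Finset K, Subfield.closure (s : Set K) = ⊤) →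
        ∀ (X₀ : Scheme.{0}) (f₀ : X₀ ⟶ Spec (.of K)),
          IsSeparated f₀ → LocallyOfFiniteType f₀ → QuasiCompact f₀ →
          (∃ (L : Type) (_ : Field L) (_ : PerfectField L) (_ : Algebra K L)
              (_ : IsPurelyInseparable K L),
              IsIntegral (pullback f₀ (Spec.map (CommRingCat.ofHom (algebraMap K L))))) →
          ∃ (K' : Type) (_ : Field K') (_ : Algebra K K') (_ : IsPurelyInseparable K K')
            (_ : Module.Finite K K') (Y : Scheme.{0})
            (π : Y ⟶ pullback f₀ (Spec.map (CommRingCat.ofHom (algebraMap K K')))),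
            IsProper π ∧ IsBirational π ∧
              Smooth (π ≫ pullback.snd f₀ (Spec.map (CommRingCat.ofHom (algebraMap K K'))))) :
    Summit.ResolutionOfSingularities.ResolutionOfSingularities.Theses.UniversalCells.PrimeFieldToPerfect := by
  intro p hp h₀ k _ _ _ X f hs hl hq hr
  -- prime field ⇒ finitely generated fields (stub_spreadOut)
  have hFG : ∀ (K : Type) [Field K] [CharP K p], (∃ s : Finset K, Subfield.closure (s : Set K) = ⊤) →
      ∀ (X : Scheme.{0}) (f : X ⟶ Spec (.of K)), IsSeparated f → LocallyOfFiniteType f →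
        QuasiCompact f → IsIntegral X → Scheme.HasResolution X :=
    fun K _ _ hK X f hs hl hq hX => stub_spreadOut p hp h₀ K hK X f hs hl hq hX
  -- ⇒ perfect closures of finitely generated fields (kernel + stub_limitDescent)
  have hPC : ∀ (K : Type) [Field K] [CharP K p], (∃ s : Finset K, Subfield.closure (s : Set K) = ⊤) →
      ∀ (L : Type) [Field L] [PerfectField L] [Algebra K L] [IsPurelyInseparable K L]
        (X : Scheme.{0}) (f : X ⟶ Spec (.of L)), IsSeparated f → LocallyOfFiniteType f →
          QuasiCompact f → IsIntegral X → Scheme.HasResolution X :=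
    fun K _ _ hK L _ _ _ _ X f hs hl hq hX =>
      stub_limitDescent p hp (fun K _ _ hK => hST p hp h₀ hFG K hK) K hK L X f hs hl hq hX
  -- ⇒ all perfect fields, integral schemes (stub_separableDescent)
  have hInt : ∀ (Y : Scheme.{0}) (g : Y ⟶ Spec (.of k)), IsSeparated g → LocallyOfFiniteType g →
      QuasiCompact g → IsIntegral Y → Scheme.HasResolution Y :=
    fun Y g hs' hl' hq' hint => stub_separableDescent p hp hPC k Y g hs' hl' hq' hint
  -- ⇒ reduced schemes over the fixed perfect field k (stmt-0551)
  exact Summit.ResolutionOfSingularities.ResolutionOfSingularities.Theorems.descentReducedToIntegral_proof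
    k hInt X f hs hl hq hr

end Summit.ResolutionOfSingularities.ResolutionOfSingularities.Theorems.PrimeFieldToPerfect

end
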